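import Literature.Barriers.CriticalPhenomena.TreesPercolatingAtCriticalityWitness
import Literature.Barriers.CriticalPhenomena.TreesPercolatingAtCriticalityProofs
import Literature.Probability.Percolation.BernoulliPercolation
import Literature.Probability.Percolation.SecondMomentMethod
import Mathlib.Combinatorics.SimpleGraph.Acyclic
import Mathlib.Algebra.Order.BigOperators.Group.LocallyFinite
import HarnessLib

/-!
# Spherically symmetric trees on `ℕ`: tree structure and the percolation estimates of
# Lyons–Peres 2016, Prop. 5.8 / Prop. 5.11 / Exercise 5.51 (b)

Proofs for the definitions of `TreesPercolatingAtCriticalityWitness.lean` (`LevelSeq`, `T`,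
`chain`, `levelSet`, `meet`, `openPath`, `openLevel`), for an ARBITRARY sequence of positive
child counts `L : LevelSeq`:

* `LevelSeq.T_isTree`: `T` is a tree (connected through the paths `chain v` to the root; every
  edge `{par c, c}` is a bridge, since a walk from outside the set of descendants of `c` into it
  must use that edge), with finite neighbourhoods of size `≤ c (level v) + 1`
  (`ncard_neighborSet_le`); `chain v` is a path of length `level v` whose edges are the pairs
  `{par^i v, par^{i+1} v}` (`mem_edges_chain_iff`), and level `n` = the vertices at the end of a
  path of length `n` from the root (`level_eq_of_isPath`).
* the two counting facts of the second-moment computation (Lyons–Peres 2016, (5.11) p. 232):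
  the paths of two level-`n` vertices `x, y` share at most `n - meet x y` edges
  (`card_inter_le`, so `|E x ∪ E y| ≥ n + meet x y`, `le_card_union`), and at most
  `∏_{n-i ≤ j < n} c j = |T_n|/|T_{n-i}|` level-`n` vertices meet `x` at height `i`
  (`card_filter_meet_le`, spherical symmetry);
* the estimates for Bernoulli bond percolation `P_p = bondPercolation T p` rooted at `0`:
  `P_p(A_x) = p^n` and `P_p(A_x ∩ A_y) ≤ p^{n + meet x y}` for `x, y ∈ T_n`
  (`real_openPath`, `real_openPath_inter_le`; `A_x = openPath x`), the second moment
  `∑_{x,y ∈ T_n} P_p(A_x ∩ A_y) ≤ (|T_n| p^n)² ∑_{k ≤ n} (|T_k| p^k)⁻¹`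
  (`sum_sum_real_openPath_inter_le`), hence by the second-moment method
  (`Literature.Probability.Percolation.sq_sum_measureReal_le_measureReal_biUnion_mul_sum`,
  Lyons–Peres Prop. 5.11) **Exercise 5.51 (b) in quantitative form**:
  `P_p(o ↔ T_n) ≥ 1 / ∑_{k ≤ n} (|T_k| p^k)⁻¹` (`one_div_le_real_openLevel`) and
  `θ_o(p) ≥ 1/S` whenever all these partial sums are `≤ S` (`one_div_le_theta`, via
  `⋂_n {o ↔ T_n} ⊆ {|C(o)| = ∞}` and continuity from above); and the first-moment bound
  `θ_o(p) ≤ |T_n| p^n` (`theta_le`, from `theta_le_card_level_mul_pow` of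
  `TreesPercolatingAtCriticalityProofs.lean`, Lyons–Peres Prop. 5.8 / (5.6)).

## References

* R. Lyons, Y. Peres, *Probability on Trees and Networks*, CUP 2016: §1.2 (p. 70), §5.2 Prop. 5.8
  and (5.6) (p. 229), §5.3 Prop. 5.11 (p. 231) and (5.11) (p. 232), (5.9), Exercise 5.51 (p. 268).
-/

noncomputable section

namespace Literature.Barriers.CriticalPhenomena

open MeasureTheory Finset Filter Topology
open Literature.Probability.Percolation

namespace LevelSeq

variable (L : LevelSeq)

/-! ### Ancestors and indices -/

/-- The index of the ancestor `i` levels up is the index divided by the product of the child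
counts of the levels in between (spherical symmetry: siblings occupy consecutive indices).
[cite: LyonsPeres2016, §1.2 (p. 70)] -/
theorem idx_iterate_par {v n : ℕ} (hv : L.level v = n) {i : ℕ} (hi : i ≤ n) :
    L.idx (L.par^[i] v) = L.idx v / ∏ j ∈ Ico (n - i) n, L.c j := by
  induction i with
  | zero => simp
  | succ i ih =>
    have hi' : i ≤ n := Nat.le_of_succ_le hi
    have hprod : ∏ j ∈ Ico (n - (i + 1)) n, L.c j =
        L.c (n - (i + 1)) * ∏ j ∈ Ico (n - i) n, L.c j := by
      rw [Finset.prod_eq_prod_Ico_succ_bot (by omega : n - (i + 1) < n)]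
      have : n - (i + 1) + 1 = n - i := by omega
      rw [this]
    rw [Function.iterate_succ_apply', idx_par, ih hi', level_iterate_par, hv,
      Nat.div_div_eq_div_mul, Nat.sub_sub, hprod,
      Nat.mul_comm (∏ j ∈ Ico (n - i) n, L.c j) (L.c (n - (i + 1)))]

/-- `|T_n| = |T_k| ∏_{k ≤ j < n} c j`. [folklore] -/
theorem N_eq_mul_prod_Ico {k n : ℕ} (hk : k ≤ n) : L.N n = L.N k * ∏ j ∈ Ico k n, L.c j := by
  rw [N, N, Finset.prod_range_mul_prod_Ico _ hk]

/-! ### Neighbourhoods: degree `≤ c (level v) + 1` -/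

/-- The children of `v` are among the `c (level v)` vertices
`s (level v + 1) + c (level v) * idx v + r`, `r < c (level v)`. [folklore] -/
theorem eq_of_par_eq {u v : ℕ} (hu : 0 < u) (h : L.par u = v) :
    ∃ r < L.c (L.level v), u = L.s (L.level v + 1) + (L.c (L.level v) * L.idx v + r) := by
  obtain ⟨n, hn⟩ : ∃ n, L.level u = n + 1 := Nat.exists_eq_succ_of_ne_zero (L.level_pos hu).ne'
  have hlv : L.level v = n := by rw [← h, level_par, hn, Nat.add_sub_cancel]
  have hiv : L.idx v = L.idx u / L.c n := by rw [← h, idx_par, hn, Nat.add_sub_cancel]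
  refine ⟨L.idx u % L.c n, by rw [hlv]; exact Nat.mod_lt _ (L.c_pos n), ?_⟩
  rw [hlv, hiv, Nat.div_add_mod, ← hn, s_add_idx]

/-- A finite set containing all neighbours of `v`: its parent and its candidate children.
[folklore] -/
theorem neighborSet_subset (v : ℕ) :
    L.T.neighborSet v ⊆ ↑(insert (L.par v) ((range (L.c (L.level v))).image
      fun r => L.s (L.level v + 1) + (L.c (L.level v) * L.idx v + r))) := by
  intro w hw
  rw [SimpleGraph.mem_neighborSet, T_adj] at hw
  obtain ⟨hne, h | h⟩ := hw
  · have hw0 : 0 < w := by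
      rcases Nat.eq_zero_or_pos w with rfl | hw0
      · rw [par_zero] at h; exact absurd h.symm hne
      · exact hw0
    obtain ⟨r, hr, hwr⟩ := L.eq_of_par_eq hw0 h
    rw [Finset.coe_insert, Finset.coe_image]
    exact Set.mem_insert_of_mem _ ⟨r, Finset.mem_coe.2 (Finset.mem_range.2 hr), hwr.symm⟩
  · rw [Finset.coe_insert]
    exact Set.mem_insert_iff.2 (Or.inl h.symm)

/-- **`T` is locally finite.** [cite: LyonsPeres2016, §1.2 (p. 70)] -/
theorem neighborSet_finite (v : ℕ) : (L.T.neighborSet v).Finite :=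
  (Finset.finite_toSet _).subset (L.neighborSet_subset v)

/-- **Degree bound: `deg v ≤ c (level v) + 1`** (its children and its parent).
[cite: LyonsPeres2016, §1.2 (p. 70)] -/
theorem ncard_neighborSet_le (v : ℕ) : (L.T.neighborSet v).ncard ≤ L.c (L.level v) + 1 := by
  refine (Set.ncard_le_ncard (L.neighborSet_subset v) (Finset.finite_toSet _)).trans ?_
  rw [Set.ncard_coe_finset]
  refine (Finset.card_insert_le _ _).trans ?_
  rw [Nat.add_le_add_iff_right]
  exact Finset.card_image_le.trans (Finset.card_range _).le

/-! ### The path to the root -/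

/-- The path to the root has length `level v`. [folklore] -/
theorem length_chain (v : ℕ) : (L.chain v).length = L.level v := by
  induction v using Nat.strong_induction_on with
  | _ v ih =>
    rcases Nat.eq_zero_or_pos v with rfl | hv
    · rw [chain_zero, SimpleGraph.Walk.length_nil, level_zero]
    · rw [L.chain_of_pos hv, SimpleGraph.Walk.length_cons, ih _ (L.par_lt hv), level_par]
      have := L.level_pos hv
      omega

/-- The vertices on the path to the root from `v` are `≤ v`. [folklore] -/
theorem le_of_mem_support_chain {v u : ℕ} (hu : u ∈ (L.chain v).support) : u ≤ v := by
  induction v using Nat.strong_induction_on generalizing u with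
  | _ v ih =>
    rcases Nat.eq_zero_or_pos v with rfl | hv
    · rw [chain_zero, SimpleGraph.Walk.support_nil, List.mem_singleton] at hu
      exact hu.le
    · rw [L.chain_of_pos hv, SimpleGraph.Walk.support_cons, List.mem_cons] at hu
      rcases hu with rfl | hu
      · exact le_rfl
      · exact (ih _ (L.par_lt hv) hu).trans (L.par_lt hv).le

/-- The path to the root is a path (no repeated vertex). [folklore] -/
theorem isPath_chain (v : ℕ) : (L.chain v).IsPath := by
  induction v using Nat.strong_induction_on with
  | _ v ih =>
    rcases Nat.eq_zero_or_pos v with rfl | hv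
    · rw [chain_zero]; exact SimpleGraph.Walk.IsPath.nil
    · rw [L.chain_of_pos hv, SimpleGraph.Walk.cons_isPath_iff]
      refine ⟨ih _ (L.par_lt hv), fun hmem => ?_⟩
      exact absurd (L.le_of_mem_support_chain hmem) (not_le.2 (L.par_lt hv))

/-- The edges of the path to the root are the pairs `{par^i v, par^{i+1} v}`, `i < level v`.
[folklore] -/
theorem mem_edges_chain_iff (v : ℕ) (e : Sym2 ℕ) :
    e ∈ (L.chain v).edges ↔ ∃ i < L.level v, e = s(L.par^[i] v, L.par^[i+1] v) := by
  induction v using Nat.strong_induction_on generalizing e with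
  | _ v ih =>
    rcases Nat.eq_zero_or_pos v with rfl | hv
    · simp [chain_zero, level_zero]
    · rw [L.chain_of_pos hv, SimpleGraph.Walk.edges_cons, List.mem_cons, ih _ (L.par_lt hv),
        level_par]
      have hl := L.level_pos hv
      constructor
      · rintro (rfl | ⟨i, hi, rfl⟩)
        · exact ⟨0, hl, rfl⟩
        · exact ⟨i + 1, by omega, by simp only [Function.iterate_succ_apply]⟩
      · rintro ⟨i, hi, rfl⟩
        rcases i with _ | i
        · exact Or.inl rfl
        · exact Or.inr ⟨i, by omega, by simp only [Function.iterate_succ_apply]⟩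

/-- The path from the parent is contained in the path from the child. [folklore] -/
theorem edges_chain_par_subset {v : ℕ} (hv : 0 < v) :
    (L.chain (L.par v)).edges ⊆ (L.chain v).edges := by
  rw [L.chain_of_pos hv, SimpleGraph.Walk.edges_cons]
  exact List.subset_cons_self _ _

/-- The path to the root from `v` has `level v` distinct edges. [folklore] -/
theorem card_edges_toFinset (v : ℕ) : (L.chain v).edges.toFinset.card = L.level v := by
  rw [List.toFinset_card_of_nodup (L.isPath_chain v).isTrail.edges_nodup,
    SimpleGraph.Walk.length_edges, length_chain]

/-! ### `T` is a tree -/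

/-- **`T` is connected** (every vertex is joined to the root by `chain`). [cite: LyonsPeres2016, §1.2 (p. 70)] -/
theorem T_connected : L.T.Connected := by
  haveI : Nonempty ℕ := ⟨0⟩
  exact SimpleGraph.Connected.mk fun u v => (L.chain u).reachable.trans (L.chain v).reachable.symm

/-- No ancestor of a vertex `v < c` is `c`. [folklore] -/
theorem iterate_par_ne_of_lt {c v : ℕ} (h : v < c) (k : ℕ) : L.par^[k] v ≠ c :=
  ((L.iterate_par_le k v).trans_lt h).ne

/-- **`T` is acyclic**: every edge `{par c, c}` is a bridge, because a walk from `par c` (not a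
descendant of `c`) to `c` must enter the set of descendants of `c`, and the only edge between that
set and its complement is `{par c, c}`. [cite: LyonsPeres2016, §1.2 (p. 70)] -/
theorem T_isAcyclic : L.T.IsAcyclic := by
  rw [SimpleGraph.isAcyclic_iff_forall_adj_isBridge]
  -- it suffices to treat the edges `(par c, c)`
  suffices h : ∀ c : ℕ, 0 < c → L.T.IsBridge s(L.par c, c) by
    intro v w hvw
    obtain ⟨hne, h1 | h1⟩ := (L.T_adj v w).1 hvw
    · have hw : 0 < w := by
        rcases Nat.eq_zero_or_pos w with rfl | hw
        · rw [par_zero] at h1; exact absurd h1.symm hne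
        · exact hw
      rw [← h1]; exact h w hw
    · have hv : 0 < v := by
        rcases Nat.eq_zero_or_pos v with rfl | hv
        · rw [par_zero] at h1; exact absurd h1 hne
        · exact hv
      rw [Sym2.eq_swap, ← h1]; exact h v hv
  intro c hc
  rw [SimpleGraph.isBridge_iff_forall_walk_mem_edges]
  -- `D` = the descendants of `c`
  set D : Set ℕ := {v | ∃ k, L.par^[k] v = c} with hD
  have hcD : c ∈ D := ⟨0, rfl⟩
  have hpcD : L.par c ∉ D := by
    rintro ⟨k, hk⟩
    exact L.iterate_par_ne_of_lt (L.par_lt hc) k hk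
  -- the only edge from outside `D` into `D` is `(par c, c)`
  have hcross : ∀ u x : ℕ, L.T.Adj u x → u ∉ D → x ∈ D → s(u, x) = s(L.par c, c) := by
    intro u x hux hu hx
    obtain ⟨hne, h1 | h1⟩ := (L.T_adj u x).1 hux
    · obtain ⟨k, hk⟩ := hx
      rcases k with _ | k
      · simp only [Function.iterate_zero, id_eq] at hk
        rw [hk] at h1; rw [← h1, hk]
      · exact absurd ⟨k, by rwa [Function.iterate_succ_apply, h1] at hk⟩ hu
    · obtain ⟨k, hk⟩ := hx
      exact absurd ⟨k + 1, by rw [Function.iterate_succ_apply, h1, hk]⟩ hu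
  -- every walk from outside `D` into `D` uses that edge
  have key : ∀ (u v : ℕ) (w : L.T.Walk u v), u ∉ D → v ∈ D → s(L.par c, c) ∈ w.edges := by
    intro u v w
    induction w with
    | nil => intro hu hv; exact absurd hv hu
    | @cons u x v hux w ih =>
      intro hu hv
      rw [SimpleGraph.Walk.edges_cons, List.mem_cons]
      by_cases hx : x ∈ D
      · exact Or.inl (hcross u x hux hu hx).symm
      · exact Or.inr (ih hx hv)
  exact fun w => key _ _ w hpcD hcD

/-- **`T` is a tree.** [cite: LyonsPeres2016, §1.2 (p. 70)] -/
theorem T_isTree : L.T.IsTree := ⟨L.T_connected, L.T_isAcyclic⟩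

/-! ### Levels -/

/-- Vertices of level `n + 1` are not the root. [folklore] -/
theorem pos_of_mem_levelSet {n v : ℕ} (hv : v ∈ L.levelSet (n + 1)) : 0 < v := by
  rw [mem_levelSet] at hv
  rcases Nat.eq_zero_or_pos v with rfl | h
  · rw [level_zero] at hv; exact absurd hv (by omega)
  · exact h

/-- The parent of a level-`(n+1)` vertex has level `n`. [folklore] -/
theorem par_mem_levelSet {n v : ℕ} (hv : v ∈ L.levelSet (n + 1)) : L.par v ∈ L.levelSet n := by
  rw [mem_levelSet] at hv ⊢
  rw [level_par, hv, Nat.add_sub_cancel]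

/-- A vertex reached from the root by a path of length `n` has level `n` (uniqueness of paths in
the tree, `SimpleGraph.IsAcyclic.path_unique`). [folklore] -/
theorem level_eq_of_isPath {v : ℕ} (w : L.T.Walk 0 v) (hw : w.IsPath) : L.level v = w.length := by
  have huniq := L.T_isAcyclic.path_unique ⟨w, hw⟩ ⟨(L.chain v).reverse, (L.isPath_chain v).reverse⟩
  have : w = (L.chain v).reverse := congrArg Subtype.val huniq
  rw [this, SimpleGraph.Walk.length_reverse, length_chain]

/-- **Spherical symmetry, counting form:** among the vertices of level `n`, at most
`∏_{k ≤ j < n} c j = |T_n| / |T_k|` have a given ancestor `n - k` generations up.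
[cite: LyonsPeres2016, §1.2 (p. 70)] -/
theorem card_filter_iterate_par_eq_le (n k z : ℕ) (hk : k ≤ n) :
    ((L.levelSet n).filter fun y => L.par^[n - k] y = z).card ≤ ∏ j ∈ Ico k n, L.c j := by
  set Q := ∏ j ∈ Ico k n, L.c j with hQ
  have hQpos : 0 < Q := prod_pos fun j _ => L.c_pos j
  have hmaps : ∀ y ∈ (L.levelSet n).filter (fun y => L.par^[n - k] y = z),
      L.idx y ∈ Finset.Ico (L.idx z * Q) (L.idx z * Q + Q) := by
    intro y hy
    rw [Finset.mem_filter, mem_levelSet] at hy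
    have hidx : L.idx z = L.idx y / Q := by
      rw [← hy.2, L.idx_iterate_par hy.1 (Nat.sub_le n k), Nat.sub_sub_self hk]
    rw [Finset.mem_Ico, hidx]
    exact ⟨Nat.div_mul_le_self _ _, Nat.lt_div_mul_add hQpos⟩
  have hinj : Set.InjOn L.idx ↑((L.levelSet n).filter fun y => L.par^[n - k] y = z) := by
    intro y hy y' hy' h
    rw [Finset.coe_filter, Set.mem_setOf_eq, mem_levelSet] at hy hy'
    exact L.eq_of_level_eq_of_idx_eq (hy.1.trans hy'.1.symm) h
  calc ((L.levelSet n).filter fun y => L.par^[n - k] y = z).card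
      ≤ (Finset.Ico (L.idx z * Q) (L.idx z * Q + Q)).card :=
        Finset.card_le_card_of_injOn L.idx hmaps hinj
    _ = Q := by rw [Nat.card_Ico]; omega

/-! ### Common edges of two paths to the root (Lyons–Peres (5.11)) -/

/-- Two path edges of vertices of the same level coincide only at the same height and with the
same lower endpoint. [folklore] -/
theorem iterate_eq_of_edge_eq {x y n i j : ℕ} (hx : L.level x = n) (hy : L.level y = n)
    (hi : i < n) (hj : j < n)
    (h : s(L.par^[i] x, L.par^[i+1] x) = s(L.par^[j] y, L.par^[j+1] y)) :
    i = j ∧ L.par^[i] x = L.par^[j] y := by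
  have hli := L.level_iterate_par i x
  have hli1 := L.level_iterate_par (i+1) x
  have hlj := L.level_iterate_par j y
  have hlj1 := L.level_iterate_par (j+1) y
  rw [hx] at hli hli1
  rw [hy] at hlj hlj1
  rcases Sym2.eq_iff.1 h with ⟨h1, h2⟩ | ⟨h1, h2⟩
  · refine ⟨?_, h1⟩
    have := congrArg L.level h1
    rw [hli, hlj] at this
    omega
  · exfalso
    have e1 := congrArg L.level h1
    have e2 := congrArg L.level h2
    rw [hli, hlj1] at e1
    rw [hli1, hlj] at e2
    omega

/-- Vertices of level `n` meet at height `≤ n` (at the root at the latest). [folklore] -/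
theorem meet_le_of_level {x y n : ℕ} (hx : L.level x = n) (hy : L.level y = n) : L.meet x y ≤ n :=
  L.meet_le (by rw [L.iterate_par_eq_zero hx.le, L.iterate_par_eq_zero hy.le])

/-- **The paths to the root of two level-`n` vertices share at most `n - meet x y` edges**
(they share exactly the edges above `x ∧ y`; Lyons–Peres 2016, (5.11):
`P[o ↔ x, o ↔ y] = P[o ↔ x] P[o ↔ y] / P[o ↔ x ∧ y]`). [cite: LyonsPeres2016, (5.11) (p. 232)] -/
theorem card_inter_le {x y n : ℕ} (hx : L.level x = n) (hy : L.level y = n) :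
    ((L.chain x).edges.toFinset ∩ (L.chain y).edges.toFinset).card ≤ n - L.meet x y := by
  classical
  have hsub : (L.chain x).edges.toFinset ∩ (L.chain y).edges.toFinset ⊆
      (Finset.Ico (L.meet x y) n).image fun i => s(L.par^[i] x, L.par^[i+1] x) := by
    intro e he
    rw [Finset.mem_inter, List.mem_toFinset, List.mem_toFinset, mem_edges_chain_iff,
      mem_edges_chain_iff, hx, hy] at he
    obtain ⟨⟨i, hi, rfl⟩, ⟨j, hj, hij⟩⟩ := he
    obtain ⟨rfl, h2⟩ := L.iterate_eq_of_edge_eq hx hy hi hj hij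
    rw [Finset.mem_image]
    exact ⟨i, Finset.mem_Ico.2 ⟨L.meet_le h2, hi⟩, rfl⟩
  calc _ ≤ ((Finset.Ico (L.meet x y) n).image fun i => s(L.par^[i] x, L.par^[i+1] x)).card :=
        Finset.card_le_card hsub
    _ ≤ (Finset.Ico (L.meet x y) n).card := Finset.card_image_le
    _ = n - L.meet x y := Nat.card_Ico _ _

/-- `|E x ∪ E y| ≥ n + meet x y` for `x, y` of level `n` (`E v` = the edges of the path to `v`).
[cite: LyonsPeres2016, (5.11) (p. 232)] -/
theorem le_card_union {x y n : ℕ} (hx : L.level x = n) (hy : L.level y = n) :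
    n + L.meet x y ≤ ((L.chain x).edges.toFinset ∪ (L.chain y).edges.toFinset).card := by
  have h1 := Finset.card_union_add_card_inter (L.chain x).edges.toFinset (L.chain y).edges.toFinset
  rw [card_edges_toFinset, card_edges_toFinset, hx, hy] at h1
  have h2 := L.card_inter_le hx hy
  have h3 := L.meet_le_of_level hx hy
  omega

/-- **The level-`n` vertices meeting `x` at height `i` descend from `par^i x`, so there are at most
`∏_{n-i ≤ j < n} c j = |T_n| / |T_{n-i}|` of them.** [cite: LyonsPeres2016, (5.11) (p. 232)] -/
theorem card_filter_meet_le (x : ℕ) {n i : ℕ} (hi : i ≤ n) :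
    ((L.levelSet n).filter fun y => L.meet x y = i).card ≤ ∏ j ∈ Ico (n - i) n, L.c j := by
  have hsub : ((L.levelSet n).filter fun y => L.meet x y = i) ⊆
      (L.levelSet n).filter fun y => L.par^[n - (n - i)] y = L.par^[i] x := by
    intro y hy
    rw [Finset.mem_filter] at hy ⊢
    refine ⟨hy.1, ?_⟩
    rw [Nat.sub_sub_self hi, ← hy.2]
    exact (L.meet_spec x y).symm
  exact (Finset.card_le_card hsub).trans (L.card_filter_iterate_par_eq_le n (n - i) _ (Nat.sub_le n i))

/-! ### The events `A_x = openPath x` under `P_p` -/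

/-- `A_x` is measurable (a finite intersection of one-edge cylinders). [folklore] -/
theorem measurableSet_openPath (x : ℕ) : MeasurableSet (L.openPath x) := by
  have : L.openPath x = ⋂ e ∈ (L.chain x).edges.toFinset, {ω : BondConfig ℕ | e ∈ ω} := by
    ext ω
    simp [openPath, Set.subset_def]
  rw [this]
  exact Finset.measurableSet_biInter _ fun e _ => measurableSet_mem e

/-- `{o ↔ T_n}` is measurable. [folklore] -/
theorem measurableSet_openLevel (n : ℕ) : MeasurableSet (L.openLevel n) :=
  Finset.measurableSet_biUnion _ fun x _ => L.measurableSet_openPath x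

/-- The path edges are edges of `T`. [folklore] -/
theorem coe_edges_toFinset_subset (x : ℕ) :
    (↑(L.chain x).edges.toFinset : Set (Sym2 ℕ)) ⊆ L.T.edgeSet :=
  fun _ he => (L.chain x).edges_subset_edgeSet (List.mem_toFinset.1 (Finset.mem_coe.1 he))

/-- **`P_p(A_x) = p^{|x|}`** ("`P[o ↔ e] = p^{|e|+1}`" on a tree).
[cite: LyonsPeres2016, §5.2 (p. 229)] -/
theorem real_openPath {x n : ℕ} (hx : L.level x = n) (p : unitInterval) :
    (bondPercolation L.T p).real (L.openPath x) = (p : ℝ) ^ n := by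
  rw [openPath, bondPercolation_real_setOf_subset L.T p _ (L.coe_edges_toFinset_subset x),
    card_edges_toFinset, hx]

/-- `A_x ∩ A_y` is the cylinder event of the union of the two edge sets. [folklore] -/
theorem openPath_inter (x y : ℕ) : L.openPath x ∩ L.openPath y =
    {ω | ↑((L.chain x).edges.toFinset ∪ (L.chain y).edges.toFinset) ⊆ ω} := by
  ext ω
  simp only [openPath, Set.mem_inter_iff, Set.mem_setOf_eq, Finset.coe_union, Set.union_subset_iff]

/-- **`P_p(A_x ∩ A_y) = p^{|E x ∪ E y|} ≤ p^{n + meet x y}`** for `x, y ∈ T_n`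
(`= p^{2n - |x ∧ y|}`, Lyons–Peres (5.11)). [cite: LyonsPeres2016, (5.11) (p. 232)] -/
theorem real_openPath_inter_le {x y n : ℕ} (hx : L.level x = n) (hy : L.level y = n)
    (p : unitInterval) :
    (bondPercolation L.T p).real (L.openPath x ∩ L.openPath y) ≤ (p : ℝ) ^ (n + L.meet x y) := by
  classical
  have hsub : (↑((L.chain x).edges.toFinset ∪ (L.chain y).edges.toFinset) : Set (Sym2 ℕ)) ⊆
      L.T.edgeSet := by
    rw [Finset.coe_union]
    exact Set.union_subset (L.coe_edges_toFinset_subset x) (L.coe_edges_toFinset_subset y)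
  rw [openPath_inter, bondPercolation_real_setOf_subset L.T p _ hsub]
  exact pow_le_pow_of_le_one p.2.1 p.2.2 (L.le_card_union hx hy)

/-- Row sums of the second moment:
`∑_{y ∈ T_n} P_p(A_x ∩ A_y) ≤ ∑_{i ≤ n} (∏_{n-i ≤ j < n} c j) p^{n+i}` for `x ∈ T_n`.
[cite: LyonsPeres2016, (5.11) (p. 232)] -/
theorem sum_real_openPath_inter_le {x n : ℕ} (hx : L.level x = n) (p : unitInterval) :
    ∑ y ∈ L.levelSet n, (bondPercolation L.T p).real (L.openPath x ∩ L.openPath y) ≤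
      ∑ i ∈ range (n + 1), ((∏ j ∈ Ico (n - i) n, L.c j : ℕ) : ℝ) * (p : ℝ) ^ (n + i) := by
  have hmaps : ∀ y ∈ L.levelSet n, L.meet x y ∈ range (n + 1) := fun y hy =>
    Finset.mem_range.2 (Nat.lt_succ_of_le (L.meet_le_of_level hx (L.mem_levelSet.1 hy)))
  calc ∑ y ∈ L.levelSet n, (bondPercolation L.T p).real (L.openPath x ∩ L.openPath y)
      ≤ ∑ y ∈ L.levelSet n, (p : ℝ) ^ (n + L.meet x y) :=
        Finset.sum_le_sum fun y hy => L.real_openPath_inter_le hx (L.mem_levelSet.1 hy) p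
    _ = ∑ i ∈ range (n + 1), ∑ y ∈ (L.levelSet n).filter (fun y => L.meet x y = i),
          (p : ℝ) ^ (n + L.meet x y) := (Finset.sum_fiberwise_of_maps_to hmaps _).symm
    _ = ∑ i ∈ range (n + 1),
          (((L.levelSet n).filter (fun y => L.meet x y = i)).card : ℝ) * (p : ℝ) ^ (n + i) := by
        refine Finset.sum_congr rfl fun i _ => ?_
        rw [Finset.sum_congr rfl fun y hy => by rw [(Finset.mem_filter.1 hy).2], Finset.sum_const,
          nsmul_eq_mul]
    _ ≤ ∑ i ∈ range (n + 1), ((∏ j ∈ Ico (n - i) n, L.c j : ℕ) : ℝ) * (p : ℝ) ^ (n + i) := by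
        refine Finset.sum_le_sum fun i hi => ?_
        have hi' : i ≤ n := Nat.lt_succ_iff.1 (Finset.mem_range.1 hi)
        refine mul_le_mul_of_nonneg_right ?_ (pow_nonneg p.2.1 _)
        exact_mod_cast L.card_filter_meet_le x hi'

/-- **Second moment on a spherically symmetric tree (Lyons–Peres 2016, (5.11) / Exercise 5.51):
`∑_{x,y ∈ T_n} P_p(A_x ∩ A_y) ≤ (|T_n| p^n)² ∑_{k ≤ n} (|T_k| p^k)⁻¹`**, i.e.
`E[X_n²] ≤ E[X_n]² ∑_{k ≤ n} 1/m_k` for the number `X_n` of level-`n` vertices with open path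
and `m_k = |T_k| p^k`. [cite: LyonsPeres2016, (5.11) (p. 232) and Exercise 5.51 (p. 268)] -/
theorem sum_sum_real_openPath_inter_le (n : ℕ) (p : unitInterval) (hp : 0 < (p : ℝ)) :
    ∑ x ∈ L.levelSet n, ∑ y ∈ L.levelSet n,
        (bondPercolation L.T p).real (L.openPath x ∩ L.openPath y) ≤
      ((L.N n : ℝ) * (p : ℝ) ^ n) ^ 2 * ∑ k ∈ range (n + 1), ((L.N k : ℝ) * (p : ℝ) ^ k)⁻¹ := by
  calc ∑ x ∈ L.levelSet n, ∑ y ∈ L.levelSet n,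
        (bondPercolation L.T p).real (L.openPath x ∩ L.openPath y)
      ≤ ∑ x ∈ L.levelSet n, ∑ i ∈ range (n + 1),
          ((∏ j ∈ Ico (n - i) n, L.c j : ℕ) : ℝ) * (p : ℝ) ^ (n + i) :=
        Finset.sum_le_sum fun x hx => L.sum_real_openPath_inter_le (L.mem_levelSet.1 hx) p
    _ = (L.N n : ℝ) * ∑ i ∈ range (n + 1),
          ((∏ j ∈ Ico (n - i) n, L.c j : ℕ) : ℝ) * (p : ℝ) ^ (n + i) := by
        rw [Finset.sum_const, card_levelSet, nsmul_eq_mul]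
    _ = (L.N n : ℝ) * ∑ k ∈ range (n + 1),
          ((∏ j ∈ Ico k n, L.c j : ℕ) : ℝ) * (p : ℝ) ^ (n + (n - k)) := by
        congr 1
        rw [← Finset.sum_range_reflect _ (n + 1)]
        refine Finset.sum_congr rfl fun i hi => ?_
        have hi' : i ≤ n := Nat.lt_succ_iff.1 (Finset.mem_range.1 hi)
        have h1 : n + 1 - 1 - i = n - i := by omega
        rw [h1, Nat.sub_sub_self hi']
    _ = ((L.N n : ℝ) * (p : ℝ) ^ n) ^ 2 * ∑ k ∈ range (n + 1), ((L.N k : ℝ) * (p : ℝ) ^ k)⁻¹ := by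
        rw [Finset.mul_sum, Finset.mul_sum]
        refine Finset.sum_congr rfl fun k hk => ?_
        have hk' : k ≤ n := Nat.lt_succ_iff.1 (Finset.mem_range.1 hk)
        have hN : (L.N n : ℝ) = L.N k * ((∏ j ∈ Ico k n, L.c j : ℕ) : ℝ) := by
          rw [L.N_eq_mul_prod_Ico hk']
          push_cast
          ring
        have hNk : (L.N k : ℝ) ≠ 0 := by exact_mod_cast (L.N_pos k).ne'
        have hpk : (p : ℝ) ^ k ≠ 0 := pow_ne_zero _ hp.ne'
        have e1 : (p : ℝ) ^ (n + (n - k)) * (p : ℝ) ^ k = (p : ℝ) ^ n * (p : ℝ) ^ n := by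
          rw [← pow_add, ← pow_add]
          congr 1
          omega
        rw [eq_mul_inv_iff_mul_eq₀ (mul_ne_zero hNk hpk)]
        calc (L.N n : ℝ) * (((∏ j ∈ Ico k n, L.c j : ℕ) : ℝ) * (p : ℝ) ^ (n + (n - k))) *
              ((L.N k : ℝ) * (p : ℝ) ^ k)
            = (L.N n : ℝ) * ((L.N k : ℝ) * ((∏ j ∈ Ico k n, L.c j : ℕ) : ℝ)) *
                ((p : ℝ) ^ (n + (n - k)) * (p : ℝ) ^ k) := by ring
          _ = (L.N n : ℝ) * (L.N n : ℝ) * ((p : ℝ) ^ n * (p : ℝ) ^ n) := by rw [e1, ← hN]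
          _ = ((L.N n : ℝ) * (p : ℝ) ^ n) ^ 2 := by ring

/-- **First moment `m_n`: `∑_{x ∈ T_n} P_p(A_x) = |T_n| p^n`.** [cite: LyonsPeres2016, Exercise 5.51 (p. 268)] -/
theorem sum_real_openPath (n : ℕ) (p : unitInterval) :
    ∑ x ∈ L.levelSet n, (bondPercolation L.T p).real (L.openPath x) = (L.N n : ℝ) * (p : ℝ) ^ n := by
  rw [Finset.sum_congr rfl fun x hx => L.real_openPath (L.mem_levelSet.1 hx) p, Finset.sum_const,
    card_levelSet, nsmul_eq_mul]

/-- **Lyons–Peres 2016, Exercise 5.51 (b), quantitative form:** on the spherically symmetric tree,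
`P_p(o ↔ T_n) ≥ 1 / ∑_{k ≤ n} (|T_k| p^k)⁻¹` for `0 < p` (second-moment method, Prop. 5.11,
with the second moment `sum_sum_real_openPath_inter_le`).
[cite: LyonsPeres2016, Exercise 5.51 (b) (p. 268) and Prop. 5.11 (p. 231)] -/
theorem one_div_le_real_openLevel (n : ℕ) (p : unitInterval) (hp : 0 < (p : ℝ)) :
    1 / ∑ k ∈ range (n + 1), ((L.N k : ℝ) * (p : ℝ) ^ k)⁻¹ ≤
      (bondPercolation L.T p).real (L.openLevel n) := by
  set K := ∑ k ∈ range (n + 1), ((L.N k : ℝ) * (p : ℝ) ^ k)⁻¹ with hK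
  have hKpos : 0 < K :=
    Finset.sum_pos (fun k _ => inv_pos.2 (mul_pos (by exact_mod_cast L.N_pos k) (pow_pos hp k)))
      ⟨0, by simp⟩
  have hcs := sq_sum_measureReal_le_measureReal_biUnion_mul_sum (bondPercolation L.T p)
    (L.levelSet n) L.openPath (fun x _ => L.measurableSet_openPath x)
  have h2 := L.sum_sum_real_openPath_inter_le n p hp
  rw [sum_real_openPath] at hcs
  set M := (L.N n : ℝ) * (p : ℝ) ^ n with hM
  have hMpos : 0 < M := mul_pos (by exact_mod_cast L.N_pos n) (pow_pos hp n)
  set P := (bondPercolation L.T p).real (L.openLevel n) with hP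
  have hP0 : 0 ≤ P := measureReal_nonneg
  have h3 : M ^ 2 ≤ P * (M ^ 2 * K) := hcs.trans (mul_le_mul_of_nonneg_left h2 hP0)
  have hM2 : 0 < M ^ 2 := pow_pos hMpos 2
  rw [div_le_iff₀ hKpos]
  nlinarith

/-! ### From open paths to an infinite cluster: `θ_o(p) ≥ 1/S` -/

/-- `{o ↔ T_{n+1}} ⊆ {o ↔ T_n}`. [folklore] -/
theorem openLevel_succ_subset (n : ℕ) : L.openLevel (n + 1) ⊆ L.openLevel n := by
  intro ω hω
  rw [openLevel, Set.mem_iUnion₂] at hω ⊢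
  obtain ⟨x, hx, hωx⟩ := hω
  refine ⟨L.par x, L.par_mem_levelSet hx, fun e he => hωx ?_⟩
  rw [Finset.mem_coe, List.mem_toFinset] at he ⊢
  exact L.edges_chain_par_subset (L.pos_of_mem_levelSet hx) he

/-- The events `{o ↔ T_n}` decrease. [folklore] -/
theorem openLevel_antitone : Antitone L.openLevel :=
  antitone_nat_of_succ_le L.openLevel_succ_subset

/-- An open tree path joins its endpoint to the root in the open graph. [folklore] -/
theorem reachable_of_mem_openPath {x : ℕ} {ω : BondConfig ℕ} (h : ω ∈ L.openPath x) :
    (openGraph ω).Reachable 0 x := by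
  have hw : ∀ e ∈ (L.chain x).edges, e ∈ (openGraph ω).edgeSet := by
    intro e he
    have heω : e ∈ ω := h (by rw [Finset.mem_coe, List.mem_toFinset]; exact he)
    have hnd : ¬ e.IsDiag :=
      SimpleGraph.not_isDiag_of_mem_edgeSet _ ((L.chain x).edges_subset_edgeSet he)
    rw [openGraph, SimpleGraph.edgeSet_fromEdgeSet]
    exact ⟨heω, hnd⟩
  exact ⟨((L.chain x).transfer (openGraph ω) hw).reverse⟩

/-- **`⋂_n {o ↔ T_n} ⊆ {|C(o)| = ∞}`**: if every level is reached by an open tree path, the open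
cluster of the root contains vertices of every level. [cite: LyonsPeres2016, (5.9) (p. 231)] -/
theorem iInter_openLevel_subset : (⋂ n, L.openLevel n) ⊆ percolatesAt 0 := by
  intro ω hω
  rw [Set.mem_iInter] at hω
  have hx : ∀ n, ∃ x, L.level x = n ∧ x ∈ openCluster ω 0 := by
    intro n
    obtain ⟨x, hx, hωx⟩ := Set.mem_iUnion₂.1 (hω n)
    exact ⟨x, L.mem_levelSet.1 hx, L.reachable_of_mem_openPath hωx⟩
  choose f hf using hx
  have hinj : Function.Injective f := fun m n h => by rw [← (hf m).1, ← (hf n).1, h]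
  exact Set.infinite_of_injective_forall_mem hinj fun n => (hf n).2

/-- **`θ_o(p) ≥ 1/S` whenever `∑_{k ≤ n} (|T_k| p^k)⁻¹ ≤ S` for all `n`** (Lyons–Peres 2016,
Exercise 5.51 (b): `Σ_n 1/m_n < ∞ ⇒ P[o ↔ ∞] > 0` on a spherically symmetric tree; with (5.9)
`P[o ↔ ∞] = inf_Π P[o ↔ Π]`, here continuity of `P_p` along the decreasing events `{o ↔ T_n}`).
[cite: LyonsPeres2016, Exercise 5.51 (b) (p. 268) and (5.9) (p. 231)] -/
theorem one_div_le_theta (p : unitInterval) (hp : 0 < (p : ℝ)) {S : ℝ}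
    (hS : ∀ n, ∑ k ∈ range (n + 1), ((L.N k : ℝ) * (p : ℝ) ^ k)⁻¹ ≤ S) :
    1 / S ≤ theta L.T 0 p := by
  set μ := bondPercolation L.T p with hμ
  have hSpos' : ∀ n, 0 < ∑ k ∈ range (n + 1), ((L.N k : ℝ) * (p : ℝ) ^ k)⁻¹ := fun n =>
    Finset.sum_pos (fun k _ => inv_pos.2 (mul_pos (by exact_mod_cast L.N_pos k) (pow_pos hp k)))
      ⟨0, by simp⟩
  have hbound : ∀ n, 1 / S ≤ μ.real (L.openLevel n) := fun n =>
    (one_div_le_one_div_of_le (hSpos' n) (hS n)).trans (L.one_div_le_real_openLevel n p hp)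
  have htend : Tendsto (fun n => μ (L.openLevel n)) atTop (𝓝 (μ (⋂ n, L.openLevel n))) :=
    tendsto_measure_iInter_atTop (fun n => (L.measurableSet_openLevel n).nullMeasurableSet)
      L.openLevel_antitone ⟨0, measure_ne_top _ _⟩
  have htend' : Tendsto (fun n => μ.real (L.openLevel n)) atTop
      (𝓝 (μ.real (⋂ n, L.openLevel n))) :=
    (ENNReal.tendsto_toReal (measure_ne_top _ _)).comp htend
  have hle : 1 / S ≤ μ.real (⋂ n, L.openLevel n) := ge_of_tendsto' htend' hbound
  calc 1 / S ≤ μ.real (⋂ n, L.openLevel n) := hle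
    _ ≤ μ.real (percolatesAt 0) := measureReal_mono L.iInter_openLevel_subset (measure_ne_top _ _)
    _ = theta L.T 0 p := rfl

/-- **First moment (Lyons–Peres 2016, Prop. 5.8 with (5.6)): `θ_o(p) ≤ |T_n| p^n`** for every `n`
(from `theta_le_card_level_mul_pow`: the vertices at the end of a path of length `n` from the
root form the level `n`, of size `|T_n| = N n`). [cite: LyonsPeres2016, Prop. 5.8 and (5.6) (p. 229)] -/
theorem theta_le (p : unitInterval) (n : ℕ) : theta L.T 0 p ≤ (L.N n : ℝ) * (p : ℝ) ^ n := by
  classical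
  haveI : L.T.LocallyFinite := fun v => (L.neighborSet_finite v).fintype
  have h := theta_le_card_level_mul_pow L.T_isTree 0 p n
  refine h.trans (mul_le_mul_of_nonneg_right ?_ (pow_nonneg p.2.1 n))
  have hsub : (level_finite L.T 0 n).toFinset ⊆ L.levelSet n := by
    intro y hy
    rw [Set.Finite.mem_toFinset] at hy
    obtain ⟨w, hw, hwn⟩ := hy
    rw [mem_levelSet, L.level_eq_of_isPath w hw, hwn]
  exact_mod_cast (Finset.card_le_card hsub).trans (L.card_levelSet n).le

end LevelSeq

end Literature.Barriers.CriticalPhenomena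

end
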